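import Literature.InformationTheory.QuantumCodes.ConnectivityDistanceBound
import HarnessLib

/-!
# Separator normal form: `(s, p/q)`-separable connectivity graphs are `(s', 1/2)`-separable — PROVED

N. Baspin, A. Krishna, *Connectivity constrains quantum codes*, Quantum 6 (2022) 711 = arXiv:2106.00765
[BaspinKrishna2022], §2.2, Remark after Definition 12 (chunk p0009 L10–11), read on the page:

> «Remark: The constant α is not strictly important as for any α, there exists a constant c_α > 0, such that any
> (s,α)-separable graphs is (c_α · s, 1/2)-separable [lipton1979separator]. Henceforth, for brevity, we just say that
> a graph is s-separable to mean that it is (s,α)-separable for some α.»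

The cited iteration is R. J. Lipton, R. E. Tarjan, *A separator theorem for planar graphs*, SIAM J. Appl. Math. 36
(1979) 177–189 [LiptonTarjan1979] (held text `paper:doi-10-1137-0136016`, the STAN-CS-77-627 version), Corollary 3
(PDF p. 15 = printed p. 13):

> «It is natural to ask whether the constant factor of 2/3 in Theorem 1 can be reduced to 1/2 if the constant factor
> of 2√2 is allowed to increase. The answer is yes. Corollary 3. Let G be any n-vertex planar graph having
> non-negative vertex costs summing to no more than one. Then the vertices of G can be partitioned into three sets
> A, B, C such that no edge joins a vertex in A with a vertex in B, neither A nor B has total cost exceeding 1/2, and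
> C contains no more than 2√2·√n/(1−√(2/3)) vertices.» Proof (p. 15 L22 – p. 16 L8): sequences `Aᵢ, Bᵢ, Cᵢ, Dᵢ`
> partitioning `V`; «let G* be the subgraph of G induced by the vertex set D_{i−1}. Let A*, B*, C* be a vertex
> partition satisfying Corollary 2 on G*. Without loss of generality, suppose A* has no more cost than B*. Let Aᵢ be
> the set among A_{i−1} ∪ A*, B_{i−1} with less cost, let Bᵢ be the set among A_{i−1} ∪ A*, B_{i−1} with greater
> cost, let Cᵢ = C_{i−1} ∪ C*, and let Dᵢ = B*. … the total number of vertices in C is bounded by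
> Σᵢ 2√2 (2/3)^{i/2} √n».

What this file proves (KERNEL, no named fact), for generator families `g : G → 𝔽₂ⁿ × 𝔽₂ⁿ` in the vocabulary of
`ConnectivityDimensionBound.lean` (`Decoupled`, `IsHalfSeparation`, `IsHalfSeparable`, `sepSum`) and
`ConnectivityDistanceBound.lean`:
* `IsSeparableWith g p q s` — `(s, p/q)`-separability (Baspin–Krishna Definition 12 at `α = p/q`; Baspin–Guruswami–
  Krishna–Li's `2/3`-balanced separation profile is `p/q = 2/3`): every vertex set `W` splits as
  `W = A ⊔ separator ⊔ B`, `q|A|, q|B| ≤ p|W|`, no generator meets both `A` and `B`, `|separator| ≤ s(|W|)`;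
  `isSeparableWith_one_two_iff` (`p/q = 1/2` is `IsHalfSeparable`);
* `divSum s p q` — the budget `t(m) = s(m) + t(⌊pm/q⌋)` (`t(0) = 0`) of the Lipton–Tarjan iteration, `divSum_mono`,
  and its closed form `divSum_le_linear : s(m) ≤ C·m^c, c > 0 ⇒ t(m) ≤ C/(1 − (p/q)^c)·m^c`;
* **`IsSeparableWith.isHalfSeparable`** — the normal form: `(s, p/q)`-separable with `p < q`, `s` monotone ⇒
  `(divSum s p q, 1/2)`-separable, by the quoted iteration (add the smaller piece of a separation of the undecided
  part to the smaller side; the undecided part shrinks by the factor `p/q`);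
* `IsSeparableWith.exists_costHalves` — Corollary 3 AS PRINTED, with arbitrary vertex costs `w` (sides of cost
  `≤ w(W)/2`, same separator budget; the weighted form Frederickson-type `r`-divisions need);
* the printed-hypothesis corollaries: **`BaspinKrishna2022_lemma22_of_separableWith`**,
  **`BaspinKrishna2022_corollary23_of_separableWith`** (general `α = p/q`) and
  **`BaspinEtAl2024_theorem11_of_separableWith`** (`2/3`-balanced separators as printed there: for every
  `[[n,k ≥ 1,d]]` stabilizer code whose connectivity graph is `(s, p/q)`-separable with `s(m) ≤ C·m^c`, `c > 0`:
  `d ≤ 2C'/(1 − 2^{−c})·n^c`, `C' = C/(1 − (p/q)^c)`; no monotonicity hypothesis — the running maximum of `s` is used).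

FAITHFULNESS / SCOPE: separability is required of every vertex subset (induced subgraphs; a separation profile
`s_G(r) = max{sep(H) : H ⊆ G, |H| ≤ r}` gives exactly this with `s = s_G`); `α` rational (`p/q`; any real `α < 1` is
below such a fraction); the constants are explicit where print has `c_α`, `α(β,c)`. No novelty: a 1979 iteration,
formalized to discharge the `-- TODO(general form)` notes of the two files above.

## References
* [BaspinKrishna2022] §2.2 Definition 12 and Remark (arXiv:2106.00765 chunk p0008 L106 – p0009 L12).
* [LiptonTarjan1979] Corollary 3 and its proof (held PDF pp. 15–16).
* [BaspinEtAl2024] §2.3 Definitions 2.8–2.9 (arXiv:2307.03283 chunk p0006 L28–44), Theorem 1.1.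

## Mathlib / tree search
`rg 'Separable|separator' Literature/InformationTheory/QuantumCodes` (2026-08-27): only the two files above
(`α = 1/2`). Reused: `IsHalfSeparation`, `IsHalfSeparable`, `Decoupled(.symm/.mono)`, `sepSum`,
`BaspinKrishna2022_lemma22`, `BaspinKrishna2022_corollary23`, `BaspinEtAl2024_theorem11`; Mathlib `Real.rpow`.
-/

namespace Literature.InformationTheory.QuantumCodes

open Finset

variable {n : ℕ} {G : Type*} (g : G → SympVec n)

/-! ### `(s, p/q)`-separability -/

/-- **`(s, p/q)`-separability** of the connectivity graph (Definition 12 at `α = p/q`, for all induced subgraphs):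
every vertex set `W` contains disjoint `A`, `B` with `q|A| ≤ p|W|`, `q|B| ≤ p|W|`, no generator meeting both, and
`|W ∖ (A ∪ B)| ≤ s(|W|)`. (definition)
[cite: BaspinKrishna2022, §2.2 Definitions 11–12 (arXiv:2106.00765 chunk p0008 L94 – p0009 L5); BaspinEtAl2024, §2.3 Definitions 2.8–2.9 (p/q = 2/3)] -/
def IsSeparableWith (p q : ℕ) (s : ℕ → ℕ) : Prop :=
  ∀ W : Finset (Fin n), ∃ A B : Finset (Fin n), A ⊆ W ∧ B ⊆ W ∧ Disjoint A B ∧ q * #A ≤ p * #W ∧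
    q * #B ≤ p * #W ∧ Decoupled g A B ∧ #(W \ (A ∪ B)) ≤ s #W

/-- `p/q = 1/2` is the tree's `IsHalfSeparable`. [cite: BaspinKrishna2022, §2.2 Definition 12 (chunk p0008 L106 – p0009 L5)] -/
theorem isSeparableWith_one_two_iff {s : ℕ → ℕ} : IsSeparableWith g 1 2 s ↔ IsHalfSeparable g s := by
  unfold IsSeparableWith IsHalfSeparable IsHalfSeparation
  simp only [one_mul]
  constructor
  · intro h W
    obtain ⟨A, B, h1, h2, h3, h4, h5, h6, h7⟩ := h W
    exact ⟨A, B, ⟨h1, h2, h3, h4, h5, h6⟩, h7⟩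
  · intro h W
    obtain ⟨A, B, ⟨h1, h2, h3, h4, h5, h6⟩, h7⟩ := h W
    exact ⟨A, B, h1, h2, h3, h4, h5, h6, h7⟩

/-- Weakening the separator budget. [cite: BaspinKrishna2022, §2.2 Definition 12 (chunk p0008 L106 – p0009 L5)] -/
theorem IsSeparableWith.mono {p q : ℕ} {s s' : ℕ → ℕ} (h : IsSeparableWith g p q s) (hss' : ∀ m, s m ≤ s' m) :
    IsSeparableWith g p q s' := fun W => by
  obtain ⟨A, B, h1, h2, h3, h4, h5, h6, h7⟩ := h W
  exact ⟨A, B, h1, h2, h3, h4, h5, h6, h7.trans (hss' _)⟩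

/-! ### The budget of the iteration -/

/-- **The budget `t` of the Lipton–Tarjan iteration**: `t(0) = 0`, `t(m) = s(m) + t(⌊pm/q⌋)` (`p < q`): the undecided
part shrinks by the factor `p/q` at every step and each step costs one separator. (definition)
[cite: LiptonTarjan1979, Corollary 3, proof (PDF p. 16 L1–8: «Σᵢ 2√2 (2/3)^{i/2} √n»)] -/
def divSum (s : ℕ → ℕ) (p q : ℕ) (hpq : p < q) : ℕ → ℕ
  | m => if m = 0 then 0 else s m + divSum s p q hpq (p * m / q)
  termination_by m => m
  decreasing_by exact Nat.div_lt_of_lt_mul (Nat.mul_lt_mul_of_pos_right hpq (by omega))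

/-- `t(0) = 0`. [cite: LiptonTarjan1979, Corollary 3, proof (PDF p. 16 L1–8)] -/
theorem divSum_zero {s : ℕ → ℕ} {p q : ℕ} (hpq : p < q) : divSum s p q hpq 0 = 0 := by
  rw [divSum]; simp

/-- The recurrence `t(m) = s(m) + t(⌊pm/q⌋)` for `m ≠ 0`. [cite: LiptonTarjan1979, Corollary 3, proof (PDF p. 16 L1–8)] -/
theorem divSum_of_ne_zero {s : ℕ → ℕ} {p q : ℕ} (hpq : p < q) {m : ℕ} (hm : m ≠ 0) :
    divSum s p q hpq m = s m + divSum s p q hpq (p * m / q) := by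
  rw [divSum]; simp [hm]

/-- `t` is monotone when `s` is. [cite: LiptonTarjan1979, Corollary 3, proof (PDF p. 16 L1–8)] -/
theorem divSum_mono {s : ℕ → ℕ} (hs : Monotone s) {p q : ℕ} (hpq : p < q) : Monotone (divSum s p q hpq) := by
  intro m m' hmm'
  induction m' using Nat.strong_induction_on generalizing m with
  | _ m' ih =>
    by_cases hm : m = 0
    · rw [hm, divSum_zero]; exact Nat.zero_le _
    · rw [divSum_of_ne_zero hpq hm, divSum_of_ne_zero hpq (m := m') (by omega)]
      have hlt : p * m' / q < m' := Nat.div_lt_of_lt_mul (Nat.mul_lt_mul_of_pos_right hpq (by omega))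
      have := ih (p * m' / q) hlt (Nat.div_le_div_right (c := q) (Nat.mul_le_mul_left p hmm'))
      have := hs hmm'
      omega

/-! ### The normal form (Lipton–Tarjan iteration) -/

/-- **One run of the iteration.** Given sides `A`, `B` and an undecided part `D`, pairwise disjoint inside `W` and
pairwise decoupled, with `2|A|, 2|B| ≤ |W|`, there is a `1/2`-separation of `W` whose separator has at most
`|W ∖ (A ∪ B ∪ D)| + t(|D|)` vertices: separate `D = A* ⊔ C* ⊔ B*` with `|A*| ≤ |B*|`, add `A*` to the smaller
side (which stays at most half: `2(|A| + |A*|) ≤ |A| + |B| + |A*| + |B*| ≤ |W|`), and continue with `D := B*`.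
[cite: LiptonTarjan1979, Corollary 3, proof (PDF p. 15 L22 – p. 16 L8)] -/
theorem IsSeparableWith.exists_isHalfSeparation_aux {p q : ℕ} {s : ℕ → ℕ} (hsep : IsSeparableWith g p q s)
    (hpq : p < q) (hs : Monotone s) (W : Finset (Fin n)) :
    ∀ (m : ℕ) (A B D : Finset (Fin n)), #D = m → A ⊆ W → B ⊆ W → D ⊆ W → Disjoint A B → Disjoint A D →
      Disjoint B D → Decoupled g A B → Decoupled g A D → Decoupled g B D → 2 * #A ≤ #W → 2 * #B ≤ #W →
      ∃ A' B' : Finset (Fin n), IsHalfSeparation g W A' B' ∧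
        #(W \ (A' ∪ B')) ≤ #(W \ (A ∪ B ∪ D)) + divSum s p q hpq #D := by
  intro m
  induction m using Nat.strong_induction_on with
  | _ m ih =>
    intro A B D hDm hAW hBW hDW hAB hAD hBD hdAB hdAD hdBD h2A h2B
    by_cases hD0 : #D = 0
    · -- nothing left to decide
      rw [card_eq_zero] at hD0
      subst hD0
      refine ⟨A, B, ⟨hAW, hBW, hAB, h2A, h2B, hdAB⟩, ?_⟩
      rw [union_empty]
      exact Nat.le_add_right _ _
    · -- separate D and put the smaller piece on the smaller side
      subst hDm
      have hq : 0 < q := by omega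
      -- a separation of D with the smaller piece first
      have hsepD : ∃ P Q : Finset (Fin n), P ⊆ D ∧ Q ⊆ D ∧ Disjoint P Q ∧ q * #Q ≤ p * #D ∧
          Decoupled g P Q ∧ #(D \ (P ∪ Q)) ≤ s #D ∧ #P ≤ #Q := by
        obtain ⟨P, Q, hP, hQ, hPQ, hPc, hQc, hdPQ, hcard⟩ := hsep D
        rcases le_total #P #Q with hle | hle
        · exact ⟨P, Q, hP, hQ, hPQ, hQc, hdPQ, hcard, hle⟩
        · refine ⟨Q, P, hQ, hP, hPQ.symm, hPc, hdPQ.symm g, ?_, hle⟩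
          rwa [union_comm]
      obtain ⟨P, Q, hPD, hQD, hPQ, hQc, hdPQ, hcardD, hPQle⟩ := hsepD
      have hQlt : #Q < #D := by
        have : q * #Q < q * #D := lt_of_le_of_lt hQc (Nat.mul_lt_mul_of_pos_right hpq (Nat.pos_of_ne_zero hD0))
        exact Nat.lt_of_mul_lt_mul_left this
      have hPQD : #P + #Q ≤ #D := by
        rw [← card_union_of_disjoint hPQ]; exact card_le_card (union_subset hPD hQD)
      have hABD : #A + #B + #D ≤ #W := by
        rw [← card_union_of_disjoint hAB, ← card_union_of_disjoint (disjoint_union_left.2 ⟨hAD, hBD⟩)]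
        exact card_le_card (union_subset (union_subset hAW hBW) hDW)
      -- the bookkeeping common to both cases: the new separator-so-far
      have hrest : ∀ A₁ B₁ : Finset (Fin n), A₁ ∪ B₁ = A ∪ B ∪ P →
          #(W \ (A₁ ∪ B₁ ∪ Q)) ≤ #(W \ (A ∪ B ∪ D)) + s #D := by
        intro A₁ B₁ hAB₁
        rw [hAB₁]
        calc #(W \ (A ∪ B ∪ P ∪ Q)) ≤ #((W \ (A ∪ B ∪ D)) ∪ (D \ (P ∪ Q))) := by
              refine card_le_card fun x hx => ?_
              rw [mem_sdiff, mem_union, mem_union, mem_union, not_or, not_or, not_or] at hx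
              rw [mem_union, mem_sdiff, mem_sdiff, mem_union, mem_union, not_or, not_or, mem_union, not_or]
              by_cases hxD : x ∈ D
              · exact Or.inr ⟨hxD, hx.2.1.2, hx.2.2⟩
              · exact Or.inl ⟨hx.1, ⟨hx.2.1.1.1, hx.2.1.1.2⟩, hxD⟩
          _ ≤ #(W \ (A ∪ B ∪ D)) + #(D \ (P ∪ Q)) := card_union_le _ _
          _ ≤ #(W \ (A ∪ B ∪ D)) + s #D := Nat.add_le_add_left hcardD _
      have hbudget : divSum s p q hpq #Q ≤ divSum s p q hpq (p * #D / q) :=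
        divSum_mono hs hpq ((Nat.le_div_iff_mul_le hq).2 (by rw [mul_comm]; exact hQc))
      have hfinish : ∀ A₁ B₁ : Finset (Fin n), A₁ ∪ B₁ = A ∪ B ∪ P →
          (∃ A' B' : Finset (Fin n), IsHalfSeparation g W A' B' ∧
            #(W \ (A' ∪ B')) ≤ #(W \ (A₁ ∪ B₁ ∪ Q)) + divSum s p q hpq #Q) →
          ∃ A' B' : Finset (Fin n), IsHalfSeparation g W A' B' ∧
            #(W \ (A' ∪ B')) ≤ #(W \ (A ∪ B ∪ D)) + divSum s p q hpq #D := by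
        intro A₁ B₁ hAB₁ ⟨A', B', hsep', hc'⟩
        refine ⟨A', B', hsep', hc'.trans ?_⟩
        rw [divSum_of_ne_zero hpq hD0]
        have := hrest A₁ B₁ hAB₁
        omega
      -- disjointness / decoupling facts for the pieces of D
      have hAP : Disjoint A P := hAD.mono_right hPD
      have hBP : Disjoint B P := hBD.mono_right hPD
      have hAQ : Disjoint A Q := hAD.mono_right hQD
      have hBQ : Disjoint B Q := hBD.mono_right hQD
      have hdAP : Decoupled g A P := hdAD.mono g Subset.rfl hPD
      have hdBP : Decoupled g B P := hdBD.mono g Subset.rfl hPD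
      have hdAQ : Decoupled g A Q := hdAD.mono g Subset.rfl hQD
      have hdBQ : Decoupled g B Q := hdBD.mono g Subset.rfl hQD
      have hPW : P ⊆ W := hPD.trans hDW
      have hQW : Q ⊆ W := hQD.trans hDW
      rcases le_total #A #B with hAB' | hAB'
      · -- A is the smaller side: new sides A ∪ P, B
        refine hfinish (A ∪ P) B (by rw [union_right_comm]) (ih #Q hQlt (A ∪ P) B Q rfl
          (union_subset hAW hPW) hBW hQW (disjoint_union_left.2 ⟨hAB, hBP.symm⟩)
          (disjoint_union_left.2 ⟨hAQ, hPQ⟩) hBQ ?_ ?_ hdBQ ?_ h2B)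
        · intro a x hx y hy hxAP hyB
          rcases mem_union.1 hxAP with hxA | hxP
          · exact hdAB a x hx y hy hxA hyB
          · exact hdBP a y hy x hx hyB hxP
        · intro a x hx y hy hxAP hyQ
          rcases mem_union.1 hxAP with hxA | hxP
          · exact hdAQ a x hx y hy hxA hyQ
          · exact hdPQ a x hx y hy hxP hyQ
        · rw [card_union_of_disjoint hAP]; omega
      · -- B is the smaller side: new sides A, B ∪ P
        refine hfinish A (B ∪ P) (by rw [union_assoc]) (ih #Q hQlt A (B ∪ P) Q rfl hAW
          (union_subset hBW hPW) hQW (disjoint_union_right.2 ⟨hAB, hAP⟩) hAQ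
          (disjoint_union_left.2 ⟨hBQ, hPQ⟩) ?_ hdAQ ?_ h2A ?_)
        · intro a x hx y hy hxA hyBP
          rcases mem_union.1 hyBP with hyB | hyP
          · exact hdAB a x hx y hy hxA hyB
          · exact hdAP a x hx y hy hxA hyP
        · intro a x hx y hy hxBP hyQ
          rcases mem_union.1 hxBP with hxB | hxP
          · exact hdBQ a x hx y hy hxB hyQ
          · exact hdPQ a x hx y hy hxP hyQ
        · rw [card_union_of_disjoint hBP]; omega

/-- **Normal form («any (s,α)-separable graph is (c_α·s, 1/2)-separable»).** If the connectivity graph is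
`(s, p/q)`-separable with `p < q` and `s` monotone, then it is `(t, 1/2)`-separable for the budget
`t(m) = s(m) + t(⌊pm/q⌋)` (`divSum`). Start the iteration with empty sides and `D = W`.
[cite: BaspinKrishna2022, §2.2 Remark after Definition 12 (chunk p0009 L10–11); LiptonTarjan1979, Corollary 3 (PDF p. 15)] -/
theorem IsSeparableWith.isHalfSeparable {p q : ℕ} {s : ℕ → ℕ} (hsep : IsSeparableWith g p q s) (hpq : p < q)
    (hs : Monotone s) : IsHalfSeparable g (divSum s p q hpq) := by
  intro W
  have hd0 : Decoupled g (∅ : Finset (Fin n)) ∅ := fun _ _ _ _ _ h => absurd h (notMem_empty _)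
  have hdW : Decoupled g (∅ : Finset (Fin n)) W := fun _ _ _ _ _ h => absurd h (notMem_empty _)
  obtain ⟨A', B', hsep', hc⟩ := hsep.exists_isHalfSeparation_aux g hpq hs W #W ∅ ∅ W rfl (empty_subset _)
    (empty_subset _) Subset.rfl (disjoint_empty_left _) (disjoint_empty_left _) (disjoint_empty_left _) hd0 hdW hdW
    (by simp) (by simp)
  refine ⟨A', B', hsep', hc.trans (le_of_eq ?_)⟩
  simp

/-! ### Closed form of the budget for polynomial separators -/

section Real

open Real

/-- **`t(m) ≤ C/(1 − (p/q)^c)·m^c`** when `s(m) ≤ C·m^c` for all `m` and `c > 0` (the geometric series of the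
iteration: `t(m) = s(m) + t(m')` with `m' ≤ (p/q)m`, so `C + K(p/q)^c = K` closes the induction for
`K = C/(1 − (p/q)^c)`). [cite: LiptonTarjan1979, Corollary 3, proof (PDF p. 16 L1–8: the sum `Σᵢ (2/3)^{i/2}`)] -/
theorem divSum_le_linear {s : ℕ → ℕ} {p q : ℕ} (hpq : p < q) {C c : ℝ} (hsC : ∀ m : ℕ, (s m : ℝ) ≤ C * (m : ℝ) ^ c)
    (hc : 0 < c) (m : ℕ) :
    (divSum s p q hpq m : ℝ) ≤ C / (1 - ((p : ℝ) / q) ^ c) * (m : ℝ) ^ c := by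
  have hq : (0 : ℝ) < q := by exact_mod_cast (show 0 < q by omega)
  have hθ0 : 0 ≤ (p : ℝ) / q := div_nonneg (Nat.cast_nonneg _) hq.le
  have hθ1 : (p : ℝ) / q < 1 := (div_lt_one hq).2 (by exact_mod_cast hpq)
  set θc : ℝ := ((p : ℝ) / q) ^ c with hθc
  have hθc1 : θc < 1 := rpow_lt_one hθ0 hθ1 hc
  have hθc0 : 0 ≤ θc := rpow_nonneg hθ0 _
  have hC : 0 ≤ C := (Nat.cast_nonneg (s 1)).trans (by simpa using hsC 1)
  set K : ℝ := C / (1 - θc) with hK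
  have hK0 : 0 ≤ K := div_nonneg hC (by linarith)
  have hKθ : C + K * θc = K := by
    have h1 : K * (1 - θc) = C := by rw [hK]; exact div_mul_cancel₀ C (sub_pos.2 hθc1).ne'
    linear_combination (-1 : ℝ) * h1
  induction m using Nat.strong_induction_on with
  | _ m ih =>
    by_cases hm : m = 0
    · rw [hm, divSum_zero, Nat.cast_zero, zero_rpow hc.ne', mul_zero]
    · rw [divSum_of_ne_zero hpq hm, Nat.cast_add]
      have hlt : p * m / q < m := Nat.div_lt_of_lt_mul (Nat.mul_lt_mul_of_pos_right hpq (by omega))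
      have ih' := ih _ hlt
      -- (⌊pm/q⌋)^c ≤ ((p/q) m)^c = θc · m^c
      have hm' : ((p * m / q : ℕ) : ℝ) ≤ (p : ℝ) / q * m := by
        rw [div_mul_eq_mul_div, le_div_iff₀ hq]
        exact_mod_cast Nat.div_mul_le_self (p * m) q
      have hpow : ((p * m / q : ℕ) : ℝ) ^ c ≤ θc * (m : ℝ) ^ c := by
        calc ((p * m / q : ℕ) : ℝ) ^ c ≤ ((p : ℝ) / q * m) ^ c := rpow_le_rpow (Nat.cast_nonneg _) hm' hc.le
          _ = θc * (m : ℝ) ^ c := mul_rpow hθ0 (Nat.cast_nonneg _)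
      calc (s m : ℝ) + (divSum s p q hpq (p * m / q) : ℝ)
          ≤ C * (m : ℝ) ^ c + K * (θc * (m : ℝ) ^ c) :=
            add_le_add (hsC m) (ih'.trans (mul_le_mul_of_nonneg_left hpow hK0))
        _ = (C + K * θc) * (m : ℝ) ^ c := by ring
        _ = K * (m : ℝ) ^ c := by rw [hKθ]

/-! ### The printed hypotheses: Baspin–Krishna at general `α`, Baspin–Guruswami–Krishna–Li at `2/3` -/

variable {S : Submodule (ZMod 2) (SympVec n)} {k d : ℕ} {p q : ℕ} {s : ℕ → ℕ} {C c : ℝ}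

/-- **Baspin–Krishna Lemma 22 for `(s,α)`-separable connectivity graphs, `α = p/q < 1`:**
`k ≤ 𝒮'_d(𝒮'_d(n))` with `𝒮'` the recursion of Definition 20 for the normal-form budget `t = divSum s p q` (this is
the printed `c_α·s`). [cite: BaspinKrishna2022, §3.2 Lemma 22 with §2.2 Remark after Definition 12 (chunks p0012 L93–96, p0009 L10–11)] -/
theorem BaspinKrishna2022_lemma22_of_separableWith (hcode : IsAdditiveCode S k d)
    (hS : S = Submodule.span (ZMod 2) (Set.range g)) (hd : 1 ≤ d) (hsep : IsSeparableWith g p q s) (hpq : p < q)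
    (hs : Monotone s) : k ≤ sepSum (divSum s p q hpq) d (sepSum (divSum s p q hpq) d n) :=
  BaspinKrishna2022_lemma22 g hcode hS hd (hsep.isHalfSeparable g hpq hs) (divSum_mono hs hpq)

/-- **Baspin–Krishna Corollary 23 for `(s,α)`-separable connectivity graphs, `α = p/q < 1`, `s(m) ≤ C·m^c`,
`0 < c < 1`, `s` monotone:** `k·d^{2(1−c)} ≤ (C'·2^{1−c}/(2^{1−c}−1))²·n` with `C' = C/(1 − (p/q)^c)`.
[cite: BaspinKrishna2022, §3.2 Corollary 23 with §2.2 Remark after Definition 12 (chunks p0013 L6–12, p0009 L10–11)] -/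
theorem BaspinKrishna2022_corollary23_of_separableWith (hcode : IsAdditiveCode S k d)
    (hS : S = Submodule.span (ZMod 2) (Set.range g)) (hd : 1 ≤ d) (hsep : IsSeparableWith g p q s) (hpq : p < q)
    (hs : Monotone s) (hsC : ∀ m : ℕ, (s m : ℝ) ≤ C * (m : ℝ) ^ c) (hc0 : 0 < c) (hc1 : c < 1) :
    (k : ℝ) * (d : ℝ) ^ (2 * (1 - c)) ≤
      (C / (1 - ((p : ℝ) / q) ^ c) * (2 : ℝ) ^ (1 - c) / ((2 : ℝ) ^ (1 - c) - 1)) ^ 2 * n := by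
  have hq : (0 : ℝ) < q := by exact_mod_cast (show 0 < q by omega)
  have hθ0 : 0 ≤ (p : ℝ) / q := div_nonneg (Nat.cast_nonneg _) hq.le
  have hθ1 : (p : ℝ) / q < 1 := (div_lt_one hq).2 (by exact_mod_cast hpq)
  have hθc1 : ((p : ℝ) / q) ^ c < 1 := rpow_lt_one hθ0 hθ1 hc0
  have hC : 0 ≤ C := (Nat.cast_nonneg (s 1)).trans (by simpa using hsC 1)
  exact BaspinKrishna2022_corollary23 g hcode hS hd (hsep.isHalfSeparable g hpq hs) (divSum_mono hs hpq)
    (div_nonneg hC (by linarith)) hc0.le hc1 (divSum_le_linear hpq hsC hc0)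

/-- The running maximum `s̄(m) = max_{j ≤ m} s(j)`: monotone, above `s`, and still below `C·m^c` when `s` is
(`c ≥ 0`). [cite: BaspinKrishna2022, §2.2 Definition 12 (s as a bound on max{sep(G') : |G'| ≤ r}, hence WLOG monotone; chunk p0008 L106 – p0009 L5)] -/
theorem exists_monotone_ge_le_rpow (hsC : ∀ m : ℕ, (s m : ℝ) ≤ C * (m : ℝ) ^ c) (hc : 0 ≤ c) :
    ∃ s' : ℕ → ℕ, Monotone s' ∧ (∀ m, s m ≤ s' m) ∧ ∀ m : ℕ, (s' m : ℝ) ≤ C * (m : ℝ) ^ c := by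
  have hC : 0 ≤ C := (Nat.cast_nonneg (s 1)).trans (by simpa using hsC 1)
  refine ⟨fun m => (range (m + 1)).sup s, fun m m' hmm' => sup_mono (range_subset_range.2 (by omega)),
    fun m => le_sup (f := s) (self_mem_range_succ m), fun m => ?_⟩
  obtain ⟨j, hj, hjs⟩ := exists_mem_eq_sup (range (m + 1)) (nonempty_range_add_one) s
  simp only
  rw [hjs]
  refine (hsC j).trans (mul_le_mul_of_nonneg_left ?_ hC)
  exact rpow_le_rpow (Nat.cast_nonneg _) (by exact_mod_cast Nat.lt_succ_iff.1 (mem_range.1 hj)) hc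

/-- **Baspin–Guruswami–Krishna–Li Theorem 1.1 with the printed separator balance.** For every `[[n,k,d]]` stabilizer
code with `k ≥ 1`, presented by generators whose connectivity graph is `(s, p/q)`-separable (`p < q`; the paper:
`p/q = 2/3`, Definition 2.8) with `s(m) ≤ C·m^c` for all `m` and some `c > 0`:
`d ≤ 2C'/(1 − 2^{−c})·n^c` with `C' = C/(1 − (p/q)^c)` («If the separation profile of G satisfies s_G(r) ≤ βr^c
for c ∈ (0,1], then d ≤ αn^c»). No monotonicity is assumed (the running maximum of `s` is used), no degree bound.
[cite: BaspinEtAl2024, §3.2 Theorem 1.1 formal with §2.3 Definitions 2.8–2.9 (arXiv:2307.03283 chunks p0008 L57–63, p0006 L28–44)] -/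
theorem BaspinEtAl2024_theorem11_of_separableWith (hcode : IsAdditiveCode S k d)
    (hS : S = Submodule.span (ZMod 2) (Set.range g)) (hk : 1 ≤ k) (hsep : IsSeparableWith g p q s) (hpq : p < q)
    (hsC : ∀ m : ℕ, (s m : ℝ) ≤ C * (m : ℝ) ^ c) (hc : 0 < c) :
    (d : ℝ) ≤ 2 * (C / (1 - ((p : ℝ) / q) ^ c)) / (1 - (2 : ℝ) ^ (-c)) * (n : ℝ) ^ c := by
  obtain ⟨s', hs'mono, hss', hs'C⟩ := exists_monotone_ge_le_rpow hsC hc.le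
  exact BaspinEtAl2024_theorem11 g hcode hS hk ((hsep.mono g hss').isHalfSeparable g hpq hs'mono)
    (divSum_le_linear hpq hs'C hc) hc

end Real

/-! ### Corollary 3 as printed: halves by COST, for arbitrary vertex costs -/

/-- **One run of the iteration with vertex costs** (Lipton–Tarjan's Corollary 3 is stated for «non-negative vertex
costs summing to no more than one», the sides having «total cost not exceeding 1/2»): sides `A`, `B`, undecided `D`,
pairwise disjoint inside `W` and pairwise decoupled, `2·w(A), 2·w(B) ≤ w(W)`; separate `D` (by the CARDINALITY
hypothesis `IsSeparableWith`), add the cheaper piece to the cheaper side, continue with the other piece; the separator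
count is again `≤ |W ∖ (A ∪ B ∪ D)| + t(|D|)`. [cite: LiptonTarjan1979, Corollary 3 and its proof (PDF p. 15 L1 – p. 16 L8)] -/
theorem IsSeparableWith.exists_costHalves_aux {p q : ℕ} {s : ℕ → ℕ} (hsep : IsSeparableWith g p q s)
    (hpq : p < q) (hs : Monotone s) (w : Fin n → ℕ) (W : Finset (Fin n)) :
    ∀ (m : ℕ) (A B D : Finset (Fin n)), #D = m → A ⊆ W → B ⊆ W → D ⊆ W → Disjoint A B → Disjoint A D →
      Disjoint B D → Decoupled g A B → Decoupled g A D → Decoupled g B D →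
      2 * ∑ v ∈ A, w v ≤ ∑ v ∈ W, w v → 2 * ∑ v ∈ B, w v ≤ ∑ v ∈ W, w v →
      ∃ A' B' : Finset (Fin n), A' ⊆ W ∧ B' ⊆ W ∧ Disjoint A' B' ∧ Decoupled g A' B' ∧
        2 * ∑ v ∈ A', w v ≤ ∑ v ∈ W, w v ∧ 2 * ∑ v ∈ B', w v ≤ ∑ v ∈ W, w v ∧
        #(W \ (A' ∪ B')) ≤ #(W \ (A ∪ B ∪ D)) + divSum s p q hpq #D := by
  intro m
  induction m using Nat.strong_induction_on with
  | _ m ih =>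
    intro A B D hDm hAW hBW hDW hAB hAD hBD hdAB hdAD hdBD h2A h2B
    by_cases hD0 : #D = 0
    · rw [card_eq_zero] at hD0
      subst hD0
      refine ⟨A, B, hAW, hBW, hAB, hdAB, h2A, h2B, ?_⟩
      rw [union_empty]
      exact Nat.le_add_right _ _
    · subst hDm
      have hq : 0 < q := by omega
      -- a separation of D with the cheaper piece first
      have hsepD : ∃ P Q : Finset (Fin n), P ⊆ D ∧ Q ⊆ D ∧ Disjoint P Q ∧ q * #Q ≤ p * #D ∧
          Decoupled g P Q ∧ #(D \ (P ∪ Q)) ≤ s #D ∧ ∑ v ∈ P, w v ≤ ∑ v ∈ Q, w v := by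
        obtain ⟨P, Q, hP, hQ, hPQ, hPc, hQc, hdPQ, hcard⟩ := hsep D
        rcases le_total (∑ v ∈ P, w v) (∑ v ∈ Q, w v) with hle | hle
        · exact ⟨P, Q, hP, hQ, hPQ, hQc, hdPQ, hcard, hle⟩
        · refine ⟨Q, P, hQ, hP, hPQ.symm, hPc, hdPQ.symm g, ?_, hle⟩
          rwa [union_comm]
      obtain ⟨P, Q, hPD, hQD, hPQ, hQc, hdPQ, hcardD, hPQle⟩ := hsepD
      have hQlt : #Q < #D := by
        have : q * #Q < q * #D := lt_of_le_of_lt hQc (Nat.mul_lt_mul_of_pos_right hpq (Nat.pos_of_ne_zero hD0))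
        exact Nat.lt_of_mul_lt_mul_left this
      -- cost bookkeeping: w(P) + w(Q) ≤ w(D) and w(A) + w(B) + w(D) ≤ w(W)
      have hwPQ : ∑ v ∈ P, w v + ∑ v ∈ Q, w v ≤ ∑ v ∈ D, w v := by
        rw [← sum_union hPQ]; exact sum_le_sum_of_subset (union_subset hPD hQD)
      have hwABD : ∑ v ∈ A, w v + ∑ v ∈ B, w v + ∑ v ∈ D, w v ≤ ∑ v ∈ W, w v := by
        rw [← sum_union hAB, ← sum_union (disjoint_union_left.2 ⟨hAD, hBD⟩)]
        exact sum_le_sum_of_subset (union_subset (union_subset hAW hBW) hDW)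
      have hrest : ∀ A₁ B₁ : Finset (Fin n), A₁ ∪ B₁ = A ∪ B ∪ P →
          #(W \ (A₁ ∪ B₁ ∪ Q)) ≤ #(W \ (A ∪ B ∪ D)) + s #D := by
        intro A₁ B₁ hAB₁
        rw [hAB₁]
        calc #(W \ (A ∪ B ∪ P ∪ Q)) ≤ #((W \ (A ∪ B ∪ D)) ∪ (D \ (P ∪ Q))) := by
              refine card_le_card fun x hx => ?_
              rw [mem_sdiff, mem_union, mem_union, mem_union, not_or, not_or, not_or] at hx
              rw [mem_union, mem_sdiff, mem_sdiff, mem_union, mem_union, not_or, not_or, mem_union, not_or]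
              by_cases hxD : x ∈ D
              · exact Or.inr ⟨hxD, hx.2.1.2, hx.2.2⟩
              · exact Or.inl ⟨hx.1, ⟨hx.2.1.1.1, hx.2.1.1.2⟩, hxD⟩
          _ ≤ #(W \ (A ∪ B ∪ D)) + #(D \ (P ∪ Q)) := card_union_le _ _
          _ ≤ #(W \ (A ∪ B ∪ D)) + s #D := Nat.add_le_add_left hcardD _
      have hbudget : divSum s p q hpq #Q ≤ divSum s p q hpq (p * #D / q) :=
        divSum_mono hs hpq ((Nat.le_div_iff_mul_le hq).2 (by rw [mul_comm]; exact hQc))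
      have hfinish : ∀ A₁ B₁ : Finset (Fin n), A₁ ∪ B₁ = A ∪ B ∪ P →
          (∃ A' B' : Finset (Fin n), A' ⊆ W ∧ B' ⊆ W ∧ Disjoint A' B' ∧ Decoupled g A' B' ∧
            2 * ∑ v ∈ A', w v ≤ ∑ v ∈ W, w v ∧ 2 * ∑ v ∈ B', w v ≤ ∑ v ∈ W, w v ∧
            #(W \ (A' ∪ B')) ≤ #(W \ (A₁ ∪ B₁ ∪ Q)) + divSum s p q hpq #Q) →
          ∃ A' B' : Finset (Fin n), A' ⊆ W ∧ B' ⊆ W ∧ Disjoint A' B' ∧ Decoupled g A' B' ∧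
            2 * ∑ v ∈ A', w v ≤ ∑ v ∈ W, w v ∧ 2 * ∑ v ∈ B', w v ≤ ∑ v ∈ W, w v ∧
            #(W \ (A' ∪ B')) ≤ #(W \ (A ∪ B ∪ D)) + divSum s p q hpq #D := by
        intro A₁ B₁ hAB₁ ⟨A', B', h1, h2, h3, h4, h5, h6, hc'⟩
        refine ⟨A', B', h1, h2, h3, h4, h5, h6, hc'.trans ?_⟩
        rw [divSum_of_ne_zero hpq hD0]
        have := hrest A₁ B₁ hAB₁
        omega
      have hAP : Disjoint A P := hAD.mono_right hPD
      have hBP : Disjoint B P := hBD.mono_right hPD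
      have hAQ : Disjoint A Q := hAD.mono_right hQD
      have hBQ : Disjoint B Q := hBD.mono_right hQD
      have hdAP : Decoupled g A P := hdAD.mono g Subset.rfl hPD
      have hdBP : Decoupled g B P := hdBD.mono g Subset.rfl hPD
      have hdAQ : Decoupled g A Q := hdAD.mono g Subset.rfl hQD
      have hdBQ : Decoupled g B Q := hdBD.mono g Subset.rfl hQD
      have hPW : P ⊆ W := hPD.trans hDW
      have hQW : Q ⊆ W := hQD.trans hDW
      rcases le_total (∑ v ∈ A, w v) (∑ v ∈ B, w v) with hAB' | hAB'
      · -- A is the cheaper side: new sides A ∪ P, B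
        refine hfinish (A ∪ P) B (by rw [union_right_comm]) (ih #Q hQlt (A ∪ P) B Q rfl
          (union_subset hAW hPW) hBW hQW (disjoint_union_left.2 ⟨hAB, hBP.symm⟩)
          (disjoint_union_left.2 ⟨hAQ, hPQ⟩) hBQ ?_ ?_ hdBQ ?_ h2B)
        · intro a x hx y hy hxAP hyB
          rcases mem_union.1 hxAP with hxA | hxP
          · exact hdAB a x hx y hy hxA hyB
          · exact hdBP a y hy x hx hyB hxP
        · intro a x hx y hy hxAP hyQ
          rcases mem_union.1 hxAP with hxA | hxP
          · exact hdAQ a x hx y hy hxA hyQ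
          · exact hdPQ a x hx y hy hxP hyQ
        · rw [sum_union hAP]; omega
      · -- B is the cheaper side: new sides A, B ∪ P
        refine hfinish A (B ∪ P) (by rw [union_assoc]) (ih #Q hQlt A (B ∪ P) Q rfl hAW
          (union_subset hBW hPW) hQW (disjoint_union_right.2 ⟨hAB, hAP⟩) hAQ
          (disjoint_union_left.2 ⟨hBQ, hPQ⟩) ?_ hdAQ ?_ h2A ?_)
        · intro a x hx y hy hxA hyBP
          rcases mem_union.1 hyBP with hyB | hyP
          · exact hdAB a x hx y hy hxA hyB
          · exact hdAP a x hx y hy hxA hyP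
        · intro a x hx y hy hxBP hyQ
          rcases mem_union.1 hxBP with hxB | hxP
          · exact hdBQ a x hx y hy hxB hyQ
          · exact hdPQ a x hx y hy hxP hyQ
        · rw [sum_union hBP]; omega

/-- **Lipton–Tarjan Corollary 3 with costs, for `(s, p/q)`-separable generator families.** For any vertex costs
`w : Fin n → ℕ` and any vertex set `W`: `W ⊇ A ⊔ B` with no generator meeting both, `2·w(A) ≤ w(W)`, `2·w(B) ≤ w(W)`
(«neither A nor B has total cost exceeding 1/2» of the total), and `|W ∖ (A ∪ B)| ≤ t(|W|)` (`t = divSum s p q`, the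
explicit `c_α·s`). The cardinality case `w = 1` is `IsSeparableWith.isHalfSeparable`.
[cite: LiptonTarjan1979, Corollary 3 (PDF p. 15 L1–12)] -/
theorem IsSeparableWith.exists_costHalves {p q : ℕ} {s : ℕ → ℕ} (hsep : IsSeparableWith g p q s) (hpq : p < q)
    (hs : Monotone s) (w : Fin n → ℕ) (W : Finset (Fin n)) :
    ∃ A B : Finset (Fin n), A ⊆ W ∧ B ⊆ W ∧ Disjoint A B ∧ Decoupled g A B ∧
      2 * ∑ v ∈ A, w v ≤ ∑ v ∈ W, w v ∧ 2 * ∑ v ∈ B, w v ≤ ∑ v ∈ W, w v ∧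
      #(W \ (A ∪ B)) ≤ divSum s p q hpq #W := by
  have hd0 : Decoupled g (∅ : Finset (Fin n)) ∅ := fun _ _ _ _ _ h => absurd h (notMem_empty _)
  have hdW : Decoupled g (∅ : Finset (Fin n)) W := fun _ _ _ _ _ h => absurd h (notMem_empty _)
  obtain ⟨A', B', h1, h2, h3, h4, h5, h6, hc⟩ := hsep.exists_costHalves_aux g hpq hs w W #W ∅ ∅ W rfl
    (empty_subset _) (empty_subset _) Subset.rfl (disjoint_empty_left _) (disjoint_empty_left _)
    (disjoint_empty_left _) hd0 hdW hdW (by simp) (by simp)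
  refine ⟨A', B', h1, h2, h3, h4, h5, h6, hc.trans (le_of_eq ?_)⟩
  simp

end Literature.InformationTheory.QuantumCodes
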